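import Literature.MathematicalPhysics.QuantumFieldTheory.Balaban1983to89.B9PinMembersKLevelV1
import Literature.MathematicalPhysics.QuantumFieldTheory.Balaban1983to89.B9CubeSequence408Mirrors

/-!
# `Balaban1983to89.B9PinMembersKLevelV1Box` — [Balaban1985BackgroundPropagators] p. 399 (the family), p. 408 («Ω₀(□) ⊂ □⁵»), Thm 3.3 p. 399:
# THE BOX MEMBERS of the [B9] family index — the member-size row «no cover cube wraps» as a FIELD of a refined index structure (STAGE 3′(Y), (γ) EDITION)

THE PRINT (verbatim). [B9] p. 399: *«… uniformly bounded … for the whole family of (torus, k, {Ω_j}, M) for fixed d, L.»*  p. 408: *«Ω_n(□) is a cube with a center at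
the center of □ … dist(Ω₀(□)ᶜ, □⁴) < 2R₀M₀Lʲη, hence Ω₀(□) ⊂ □⁵.»*  Thm 3.3 p. 399 is stated for cubes □ of the class with `□⁵` a genuine cube of the lattice: print never
speaks to tori smaller than its boxes ([Balaban1984PropagatorsII] (2.1) p. 224: «some domains Ω_j are equal to T_η» — the terminal members are treated by the last
renormalization steps, not by Thm 3.3).

WHAT THIS FILE TYPES (the (γ) road of record, director-ym №690∕№693; referee ref-A A2).  MODULE 3's member type `B9PinMembersKLevelV1.MemberY` ranges over EVERY k-level
member, including small-period members some of whose cover cubes `□ ∈ cubes x.D` have a WRAPPING Dirichlet window (r05's fit test `B9CubeSequence408Mirrors.mirC □ μ = false`: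
«`2w₁ + 1 + 5S_{k′} ≤ N₀_μ`» fails).  A ∀-row `∀ x : MemberY …, ∀ □ μ, mirC □ μ = true` over the TYPE is false on the family (ref-A's witness member `k = 2`, `P′ = 2L`,
`R = 2L²`), hence contradictory as a displayed hypothesis.  The faithful typing restricts the QUANTIFIER RANGE: the row becomes a FIELD of a refined index structure.
* §1 `MirFitK i` — the member-size row of a k-level index `i : KIdx …` as a predicate: every cover cube of its `{Ω_j}` is mirrored in every direction; `MirFit x :=
  MirFitK x.toKIdx` for a member (so the row for the SECOND sequence is `MirFitK x.snd`, same letter; `mirFit_iff` = `Iff.rfl`).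
* §1 **`MemberYBox … Mstar`** — `MemberY` EXTENDED by the one field `hMir : ∀ □ μ, mirC □ μ = true` (shape of `KIdx.hpl`); the projection `MemberYBox.toMemberY` is the
  coercion of record (no `instance` is declared: consumers write `x.toMemberY`; every existing `MemberY` consumer is untouched — declare-once).
* §2 bookkeeping: `mirC_eq` (the row by name), `fit` (r05's `fit_of_mirC` at a box member: `2w₁ + 1 + 5S_{k′} ≤ N₀_μ`), `mirFit`, `ofMirFit` ∕ `toMemberY_ofMirFit` ∕ `ofMirFit_toMemberY`
  (`rfl`), `toMemberY_injective`, `equivSubtype : MemberYBox ≃ {x : MemberY … // MirFit x}` — so the box members ARE the sub-family `toMemberY : MemberYBox → MemberY`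
  (the (β) reading «sub-family index `f : J → MemberY`» with `J := MemberYBox`, `f := toMemberY`, injective).
* §3 ★ `forall_memberY_iff_box_and_top` — THE DISCHARGE-OR-SPLIT SEAM at the record, typed: a statement `Q` holds for every member iff it holds for every BOX member
  (N06 via the road (O1″)) and for every member violating the row (sub-row «N06-top (O4)», print's last steps); `forall_memberYBox_of_forall` (restriction).

HONEST SCOPE: an index sub-structure and bookkeeping, sorry-free; NO inhabitant of `MemberYBox` is constructed here (non-emptiness at the record = the DISCHARGE half of
N06-top (O4): the PERIODS sufficiently large relative to the windows `R·S_j`, `5S_{k′}` — open, not claimed); NO N06 head is stated here (dag-n06-d's pen re-keys «KE₂₃X-C»∕«KESC-CQ»∕Val on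
`x : MemberYBox …`); no operator, no estimate; the record's carriers (`CarriersYP`, `I9 := MemberY …`) are UNCHANGED; N06 not discharged; counts unmoved; the
Yang–Mills mass gap is NOT proved.  No `instance`, no `notation`.
-/

namespace Literature.MathematicalPhysics.QuantumFieldTheory.Balaban1983to89.B9PinMembersKLevelV1Box

open B6Cover236MultiLevelBlocks (cubes)
open B6MultiLevelBoxOperator (N0)
open B6MultiLevelTorusMirrorL0 (sTop)
open B9CubeSequence408 (wid)
open B9CubeSequence408Mirrors (mirC kTop fit_of_mirC)
open B6KLevelCensusIndexV1 (KIdx)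
open B9PinMembersKLevelV1 (MemberY)

variable (d ℓ : ℕ) (hd : 1 ≤ d + 1) (hL : Odd (ℓ + 1) ∧ 1 < ℓ + 1) (b₀ b₁ : ℝ) (Mstar : ℕ)

/-! ## §1  The member-size row and the box members -/

variable {d ℓ hd hL b₀ b₁} in
/-- **THE MEMBER-SIZE ROW** of a k-level index («no cover cube wraps»): every cover cube `□` of `{Ω_j}` is mirrored in every direction `μ`, i.e. the window of `C₁(□)` plus
five top blocks fits in the torus, `2w₁ + 1 + 5S_{k′} ≤ N₀_μ` (r05's `mirC □ μ = true`; position-free: it reads the cube's level, `R`, `M_h`, `k` and the periods only).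
[cite: Balaban1985BackgroundPropagators, p.408 («Ω₀(□) ⊂ □⁵»), Thm 3.3 p.399] -/
def MirFitK (i : KIdx d ℓ hd hL b₀ b₁) : Prop :=
  ∀ (c : ↥(cubes i.D.toDomains)) (μ : Fin (d + 1)), mirC c μ = true

variable {d ℓ hd hL b₀ b₁ Mstar} in
/-- the member-size row of a MEMBER: the row of its first sequence `{Ω_j}` (the second sequence's row is `MirFitK x.snd`). [cite: Balaban1985BackgroundPropagators, p.408, Thm 3.14 pp.426–427 (two sequences)] -/
def MirFit (x : MemberY d ℓ hd hL b₀ b₁ Mstar) : Prop :=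
  MirFitK x.toKIdx

variable {d ℓ hd hL b₀ b₁ Mstar} in
/-- the member's row, unfolded (`Iff.rfl`). [cite: Balaban1985BackgroundPropagators, p.408, bookkeeping] -/
theorem mirFit_iff (x : MemberY d ℓ hd hL b₀ b₁ Mstar) : MirFit x ↔ ∀ (c : ↥(cubes x.D.toDomains)) (μ : Fin (d + 1)), mirC c μ = true := Iff.rfl

/-- **A BOX MEMBER OF THE [B9] FAMILY INDEX** ((γ) edition): a member `(torus, k, {Ω_j}, {Ω′_j}, Λ, M)` of MODULE 3 all of whose cover cubes of `{Ω_j}` are mirrored in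
every direction — the member-size row as a FIELD (shape of `KIdx.hpl`), so that a head quantified over `x : MemberYBox …` ranges over the genuine-box members only.
[cite: Balaban1985BackgroundPropagators, Thm 3.1 p.397 + p.399 (the family), p.408 («Ω₀(□) ⊂ □⁵»), Thm 3.3 p.399] -/
structure MemberYBox extends MemberY d ℓ hd hL b₀ b₁ Mstar where
  hMir : ∀ (c : ↥(cubes D.toDomains)) (μ : Fin (d + 1)), mirC c μ = true

namespace MemberYBox

variable {d ℓ hd hL b₀ b₁ Mstar}

/-! ## §2  Bookkeeping: the row by name, the fit inequality, the sub-family reading -/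

/-- the member-size row of a box member, by name. [cite: Balaban1985BackgroundPropagators, p.408, bookkeeping] -/
theorem mirC_eq (x : MemberYBox d ℓ hd hL b₀ b₁ Mstar) (c : ↥(cubes x.D.toDomains)) (μ : Fin (d + 1)) : mirC c μ = true :=
  x.hMir c μ

/-- the fit inequality at a box member: `2w₁ + 1 + 5S_{k′} ≤ N₀_μ` for every cover cube and direction (r05's `fit_of_mirC`). [cite: Balaban1985BackgroundPropagators, p.408 («Ω₀(□) ⊂ □⁵»), bookkeeping] -/
theorem fit (x : MemberYBox d ℓ hd hL b₀ b₁ Mstar) (c : ↥(cubes x.D.toDomains)) (μ : Fin (d + 1)) :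
    2 * wid ℓ x.Mh x.R c.1.1 1 + 1 + 5 * sTop ℓ x.Mh (kTop c) ≤ (N0 ℓ x.Mh x.k x.P' μ : ℤ) :=
  fit_of_mirC (x.hMir c μ)

/-- a box member satisfies the member-size row (predicate form). [cite: Balaban1985BackgroundPropagators, p.408, bookkeeping] -/
theorem mirFit (x : MemberYBox d ℓ hd hL b₀ b₁ Mstar) : MirFit x.toMemberY :=
  x.hMir

/-- a member satisfying the row IS a box member. [cite: Balaban1985BackgroundPropagators, p.408, bookkeeping] -/
def ofMirFit (x : MemberY d ℓ hd hL b₀ b₁ Mstar) (h : MirFit x) : MemberYBox d ℓ hd hL b₀ b₁ Mstar :=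
  ⟨x, h⟩

/-- … with the same underlying member (`rfl`). [cite: Balaban1985BackgroundPropagators, p.399, bookkeeping] -/
theorem toMemberY_ofMirFit (x : MemberY d ℓ hd hL b₀ b₁ Mstar) (h : MirFit x) : (ofMirFit x h).toMemberY = x := rfl

/-- … and conversely (`rfl`, structure eta). [cite: Balaban1985BackgroundPropagators, p.399, bookkeeping] -/
theorem ofMirFit_toMemberY (x : MemberYBox d ℓ hd hL b₀ b₁ Mstar) : ofMirFit x.toMemberY x.mirFit = x := rfl

/-- the projection to MODULE 3's members is injective (the row is a proposition). [cite: Balaban1985BackgroundPropagators, p.399, bookkeeping] -/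
theorem toMemberY_injective : Function.Injective (MemberYBox.toMemberY : MemberYBox d ℓ hd hL b₀ b₁ Mstar → MemberY d ℓ hd hL b₀ b₁ Mstar) := by
  rintro ⟨x, hx⟩ ⟨y, hy⟩ h
  cases h
  rfl

/-- **THE SUB-FAMILY READING** ((β) ≡ (γ)): the box members are exactly the members satisfying the row. [cite: Balaban1985BackgroundPropagators, p.399 (the family), p.408, bookkeeping] -/
def equivSubtype : MemberYBox d ℓ hd hL b₀ b₁ Mstar ≃ {x : MemberY d ℓ hd hL b₀ b₁ Mstar // MirFit x} where
  toFun x := ⟨x.toMemberY, x.mirFit⟩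
  invFun p := ofMirFit p.1 p.2
  left_inv _ := rfl
  right_inv _ := rfl

/-- the sub-family map of the reading (β): `toMemberY ∘ equivSubtype.symm = Subtype.val` (`rfl`). [cite: Balaban1985BackgroundPropagators, p.399, bookkeeping] -/
theorem toMemberY_equivSubtype_symm (p : {x : MemberY d ℓ hd hL b₀ b₁ Mstar // MirFit x}) : (equivSubtype.symm p).toMemberY = p.1 := rfl

/-! ## §3  The discharge-or-split seam at the record -/

/-- restriction: a statement about every member holds for every box member. [cite: Balaban1985BackgroundPropagators, p.399, bookkeeping] -/
theorem forall_memberYBox_of_forall {Q : MemberY d ℓ hd hL b₀ b₁ Mstar → Prop} (h : ∀ x, Q x) (x : MemberYBox d ℓ hd hL b₀ b₁ Mstar) : Q x.toMemberY :=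
  h x.toMemberY

/-- ★ **THE DISCHARGE-OR-SPLIT SEAM**: a statement holds for EVERY member iff it holds for every BOX member (N06, road (O1″)) and for every member violating the member-size
row (sub-row «N06-top (O4)», print's last steps on the terminal small tori). [cite: Balaban1985BackgroundPropagators, p.399 (the family), p.408; Balaban1984PropagatorsII, (2.1) p.224 («some domains Ω_j are equal to T_η»)] -/
theorem forall_memberY_iff_box_and_top {Q : MemberY d ℓ hd hL b₀ b₁ Mstar → Prop} :
    (∀ x, Q x) ↔ (∀ x : MemberYBox d ℓ hd hL b₀ b₁ Mstar, Q x.toMemberY) ∧ (∀ x : MemberY d ℓ hd hL b₀ b₁ Mstar, ¬ MirFit x → Q x) := by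
  refine ⟨fun h => ⟨fun x => h x.toMemberY, fun x _ => h x⟩, fun h x => ?_⟩
  by_cases hx : MirFit x
  · exact h.1 (ofMirFit x hx)
  · exact h.2 x hx

/-- the split, pointwise: at a member satisfying the row, a box-member statement applies. [cite: Balaban1985BackgroundPropagators, p.408, bookkeeping] -/
theorem of_forall_memberYBox {Q : MemberY d ℓ hd hL b₀ b₁ Mstar → Prop} (h : ∀ x : MemberYBox d ℓ hd hL b₀ b₁ Mstar, Q x.toMemberY)
    (x : MemberY d ℓ hd hL b₀ b₁ Mstar) (hx : MirFit x) : Q x :=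
  h (ofMirFit x hx)

end MemberYBox

end Literature.MathematicalPhysics.QuantumFieldTheory.Balaban1983to89.B9PinMembersKLevelV1Box
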